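import Summits.Langlands.Langlands.Theorems.IrreducibilityBySelfDualityReciprocityUpToIrreducibilityAboveUnramified
import HarnessLib

/-!
# Line `Sketch` for the crux `ReciprocityUpToIrreducibility` (item stmt-Langlands-14328), continuation c4:
# the `v ∤ ℓ` clause of `LocalGlobalCompatibleAt` on the UNRAMIFIED sector

Support file (closes nothing; continuation lead c4, prover-line-stmt-Langlands-14328-c4-0).

The summit's local–global compatibility predicate `LocalGlobalCompatibleAt Rec ι π ρ v` asks, at a
place `v ∤ ℓ`, for a Weil–Deligne representation `r` attached to `ρ|_{W_{K_v}}` by the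
Grothendieck–Deligne recipe `IsWeilDeligneOfLadic` — a relation quantifying over a character
`t : I_{K_v} →* E` NON-TRIVIAL on an open subgroup of inertia.  At a place where `ρ` is unramified:

* `⇒` the recipe returns `(ρ|_{W_{K_v}}, N = 0)` itself as matrices
  (`IsWeilDeligneOfLadic.N_eq_zero_of_forall_inertia`, `IsWeilDeligneOfLadic.toMatrix'_ρ_eq_of_forall_inertia`),
  so the attached `r` IS `WeilDeligneRep.ofRep (ρ|_{W_{K_v}})`;
* `⇐` conversely `(ρ|_{W_{K_v}}, 0)` satisfies the recipe (`IsWeilDeligneOfLadic.of_N_eq_zero` with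
  `U = I_{K_v}`, open by `WeilGroup.isOpen_inertia`, and a geometric Frobenius from
  `WeilGroup.deg_surjective`) PROVIDED a character `t : I_{K_v} →* Multiplicative ℚ̄_ℓ` not
  identically `1` is granted — the explicit hypothesis of the registered stub below (the lead
  discharges it by a Literature theorem in the glue).

Hence `stub_awayUnramified_iff_of_inertiaCharacter`: on the unramified-at-`v` sector, `v ∤ ℓ`,
`LocalGlobalCompatibleAt Rec ι π ρ v` is EQUIVALENT to the `ℓ`-blind matching "some local component
`π_v` of `π` at `v` has `rec_v(π_v)` equal to the Frobenius-semisimple class of a transport of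
`(ρ|_{W_{K_v}}, 0)` along `ι`" — the `v ∤ ℓ` twin of c3's
`localGlobalCompatibleAt_above_iff_of_isUnramifiedAt`.  No definitions; standard axioms; no named
fact is assumed.
-/

noncomputable section

set_option linter.dupNamespace false -- project-wide option (lakefile weak.linter.dupNamespace); `Summit.Langlands.Langlands` is the mandated namespace

open scoped MatrixGroups Matrix NumberField Classical
open Filter IsDedekindDomain Field
open Literature.NumberTheory.Automorphic Literature.NumberTheory.GaloisRepresentations
open Literature.NumberTheory.PAdicHodge
open Summit.Langlands

namespace Summit.Langlands.Langlands.Theorems.ReciprocityUpToIrreducibility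

/-! ## 1. Local: the matrices of `ρ|_{W_F}` -/

section Local

variable {F : Type} [Field F] [ValuativeRel F] [TopologicalSpace F] [IsNonarchimedeanLocalField F]
  {A : Type*} [CommRing A] [TopologicalSpace A] {n : ℕ}

/-- The matrix of `ρ|_{W_F}(w)` (accepted `FramedRep.weilRestrict`, `x ↦ ρ(w) *ᵥ x`) in the standard
basis is `ρ(w)` = `ρ.toWeilGroupHom w`. [cite: TateCorvallis1979, (1.4.1)] -/
theorem toMatrix'_weilRestrict (ρ : FramedRep (absoluteGaloisGroup F) A n) (w : WeilGroup F) :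
    LinearMap.toMatrix' (ρ.weilRestrict F w) =
      ((ρ.toWeilGroupHom w : GL (Fin n) A) : Matrix (Fin n) (Fin n) A) := by
  have h : ρ.weilRestrict F w =
      Matrix.toLin' ((ρ.toWeilGroupHom w : GL (Fin n) A) : Matrix (Fin n) (Fin n) A) := by
    refine LinearMap.ext fun x => ?_
    rw [Matrix.toLin'_apply, FramedRep.weilRestrict_apply_apply, FramedRep.toWeilGroupHom_apply]
  rw [h, LinearMap.toMatrix'_toLin']

variable {E : Type*} [Field E] [CharZero E] [TopologicalSpace E]

/-- **`(ρ|_{W_F}, 0)` is attached to a locally unramified `ρ` by the Grothendieck–Deligne recipe,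
granted a character of `I_F` not identically `1`.**  Take `U = I_F` (open, `WeilGroup.isOpen_inertia`),
the given `t`, a geometric Frobenius `Φ` (`deg` is surjective), `N = 0`; `ρ|_{W_F}` kills `I_F` and the
matrices of `(ρ|_{W_F}, 0)` are those of `ρ.toWeilGroupHom` (`IsWeilDeligneOfLadic.of_N_eq_zero`).
[cite: TateCorvallis1979, (4.1.3)–(4.2.1)] [cite: DeligneAntwerpII1973, §8.4.2] -/
theorem isWeilDeligneOfLadic_ofRep_weilRestrict (ρ : FramedRep (absoluteGaloisGroup F) E n)
    (hρ : ρ.IsLocallyUnramified)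
    (ht : ∃ t : WeilGroup.inertia F →* Multiplicative E, ∃ u : WeilGroup.inertia F, t u ≠ 1) :
    IsWeilDeligneOfLadic ρ.toWeilGroupHom
      (WeilDeligneRep.ofRep (ρ.weilRestrict F) hρ.isUnramifiedRep_weilRestrict.isContinuousRep) := by
  obtain ⟨t, u, htu⟩ := ht
  obtain ⟨Φ, hΦ⟩ := WeilGroup.deg_surjective IsFrobPow.mul_holds IsFrobPow.unique_holds
    (exists_isFrobPow_holds F) (-1 : ℤ)
  refine IsWeilDeligneOfLadic.of_N_eq_zero ρ.toWeilGroupHom _ (WeilDeligneRep.ofRep_N _ _) t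
    (WeilGroup.inertia F) le_rfl (WeilGroup.isOpen_inertia F) ⟨u, u.2, htu⟩ (fun w hw => ?_) Φ hΦ
    fun m w => ?_
  · rw [FramedRep.toWeilGroupHom_apply]
    exact hρ _ (WeilGroup.mem_inertia_iff.mp hw)
  · rw [WeilDeligneRep.ofRep_ρ, toMatrix'_weilRestrict]

/-- **Conversely, at a locally unramified `ρ` the recipe returns `(ρ|_{W_F}, 0)` itself**: if `r` is
attached to `ρ.toWeilGroupHom` by `IsWeilDeligneOfLadic` and `ρ` kills `I_F`, then
`r = WeilDeligneRep.ofRep (ρ|_{W_F})` (`N = 0` at the element where `t ≠ 1`; `[r.ρ(w)] = ρ(w)` for all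
`w`). [cite: TateCorvallis1979, (4.1.3)–(4.2.1)] [cite: DeligneAntwerpII1973, §8.4.2] -/
theorem eq_ofRep_weilRestrict_of_isWeilDeligneOfLadic (ρ : FramedRep (absoluteGaloisGroup F) E n)
    (hρ : ρ.IsLocallyUnramified) {r : WeilDeligneRep F E (Fin n → E)}
    (hlad : IsWeilDeligneOfLadic ρ.toWeilGroupHom r) :
    r = WeilDeligneRep.ofRep (ρ.weilRestrict F) hρ.isUnramifiedRep_weilRestrict.isContinuousRep := by
  have hI : ∀ u ∈ WeilGroup.inertia F, ρ.toWeilGroupHom u = 1 := fun u hu => by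
    rw [FramedRep.toWeilGroupHom_apply]
    exact hρ _ (WeilGroup.mem_inertia_iff.mp hu)
  have hN : r.N = 0 := hlad.N_eq_zero_of_forall_inertia hI
  have hρW : ∀ w, r.ρ w = ρ.weilRestrict F w := fun w =>
    LinearMap.toMatrix'.injective
      ((hlad.toMatrix'_ρ_eq_of_forall_inertia hI w).trans (toMatrix'_weilRestrict ρ w).symm)
  cases r with
  | mk ρr hc N hnil hconj =>
    have h1 : ρr = ρ.weilRestrict F := MonoidHom.ext fun w => hρW w
    have h2 : N = 0 := hN
    subst h1 h2
    rfl

end Local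

/-! ## 2. The `v ∤ ℓ` clause of `LocalGlobalCompatibleAt` on the unramified sector -/

section Summit

variable {K : Type} [Field K] [NumberField K] {ℓ : ℕ} [Fact ℓ.Prime] {n : ℕ}
  {hcpt : isCompact_glFiniteIntegralLevel n K}

/-- **Unramified sector away from `ℓ`, `⇒`.**  Local–global compatibility at `v ∤ ℓ` for `ρ`
unramified at `v` yields a local component `π_v` and a transport `rℂ` along `ι` of
`(ρ|_{W_{K_v}}, 0)` ITSELF with `rℂ^{F-ss}` of class `rec_v(π_v)`: the `r` of the clause is attached
to `ρ|_{W_{K_v}}` by the Grothendieck–Deligne recipe, which at a `ρ` trivial on `I_{K_v}` returns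
`(ρ|_{W_{K_v}}, 0)` as matrices. [cite: DeligneAntwerpII1973, §8.4.2] [cite: TateCorvallis1979, (4.2.1)] -/
theorem exists_of_localGlobalCompatibleAt_away_of_isUnramifiedAt
    (Rec : ReciprocityData K) (ι : PadicAlgCl ℓ ≃+* ℂ)
    (π : AutomorphicRepData (AutomorphyDatum.gl n K hcpt)) (ρ : FramedGaloisRep K (PadicAlgCl ℓ) n)
    {v : HeightOneSpectrum (𝓞 K)} (hv : ((ℓ : ℕ) : 𝓞 K) ∉ v.asIdeal) (hρ : ρ.IsUnramifiedAt v)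
    (h : LocalGlobalCompatibleAt Rec ι π ρ v) :
    ∃ (πv : SmoothIrrep (GL (Fin n) (v.adicCompletion K)))
      (rℂ : WeilDeligneRep (v.adicCompletion K) ℂ (Fin n → ℂ)),
      π.HasLocalComponentAt v πv.ρ ∧
        (WeilDeligneRep.ofRep ((ρ.toLocal v).weilRestrict (v.adicCompletion K))
          (isLocallyUnramified_toLocal_of_isUnramifiedAt ρ v hρ).isUnramifiedRep_weilRestrict.isContinuousRep).IsTransportAlong
            (ι : PadicAlgCl ℓ →+* ℂ) rℂ ∧
        rℂ.HasFrobSemisimpleClass ((Rec.llc v).recGL n (IrrClass.mk πv)) := by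
  obtain ⟨πv, r, rℂ, hπv, hlad, -, htr, hcls⟩ := h
  have hr := eq_ofRep_weilRestrict_of_isWeilDeligneOfLadic (ρ.toLocal v)
    (isLocallyUnramified_toLocal_of_isUnramifiedAt ρ v hρ) (hlad hv)
  subst hr
  exact ⟨πv, rℂ, hπv, htr, hcls⟩

/-- **Unramified sector away from `ℓ`, `⇐`.**  At `v ∤ ℓ` with `ρ` unramified at `v`, granted a
character `t : I_{K_v} →* Multiplicative ℚ̄_ℓ` not identically `1`, a local component `π_v` of `π`
and a transport `rℂ` of `(ρ|_{W_{K_v}}, 0)` along `ι` with `rℂ^{F-ss}` of class `rec_v(π_v)` give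
`LocalGlobalCompatibleAt Rec ι π ρ v`, with `r = (ρ|_{W_{K_v}}, 0)` (attached to `ρ|_{W_{K_v}}` by
`isWeilDeligneOfLadic_ofRep_weilRestrict`; the `v ∣ ℓ` clause is vacuous).
[cite: DeligneAntwerpII1973, §8.4.2] [cite: TateCorvallis1979, (4.1.3)–(4.2.1)] -/
theorem localGlobalCompatibleAt_away_of_isUnramifiedAt
    (Rec : ReciprocityData K) (ι : PadicAlgCl ℓ ≃+* ℂ)
    (π : AutomorphicRepData (AutomorphyDatum.gl n K hcpt)) (ρ : FramedGaloisRep K (PadicAlgCl ℓ) n)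
    {v : HeightOneSpectrum (𝓞 K)} (hv : ((ℓ : ℕ) : 𝓞 K) ∉ v.asIdeal) (hρ : ρ.IsUnramifiedAt v)
    (ht : ∃ t : WeilGroup.inertia (v.adicCompletion K) →* Multiplicative (PadicAlgCl ℓ),
      ∃ u : WeilGroup.inertia (v.adicCompletion K), t u ≠ 1)
    (πv : SmoothIrrep (GL (Fin n) (v.adicCompletion K))) (hπv : π.HasLocalComponentAt v πv.ρ)
    (rℂ : WeilDeligneRep (v.adicCompletion K) ℂ (Fin n → ℂ))
    (htr : (WeilDeligneRep.ofRep ((ρ.toLocal v).weilRestrict (v.adicCompletion K))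
      (isLocallyUnramified_toLocal_of_isUnramifiedAt ρ v hρ).isUnramifiedRep_weilRestrict.isContinuousRep).IsTransportAlong
        (ι : PadicAlgCl ℓ →+* ℂ) rℂ)
    (hcls : rℂ.HasFrobSemisimpleClass ((Rec.llc v).recGL n (IrrClass.mk πv))) :
    LocalGlobalCompatibleAt Rec ι π ρ v :=
  ⟨πv, _, rℂ, hπv, fun _ => isWeilDeligneOfLadic_ofRep_weilRestrict (ρ.toLocal v)
      (isLocallyUnramified_toLocal_of_isUnramifiedAt ρ v hρ) ht,
    fun hv' => absurd hv' hv, htr, hcls⟩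

/-- **On the unramified-at-`v` sector, `v ∤ ℓ`, the clause is the `ℓ`-blind matching** (granted a
character of `I_{K_v}` with values in `ℚ̄_ℓ` not identically `1`): `LocalGlobalCompatibleAt Rec ι π ρ v`
holds iff some local component `π_v` of `π` at `v` has `rec_v(π_v)` equal to the Frobenius-semisimple
class of a transport of `(ρ|_{W_{K_v}}, N = 0)` along `ι` — the `v ∤ ℓ` twin of
`localGlobalCompatibleAt_above_iff_of_isUnramifiedAt`. [cite: DeligneAntwerpII1973, §8.4.2]
[cite: TateCorvallis1979, (4.1.3)–(4.2.1)] -/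
theorem localGlobalCompatibleAt_away_iff_of_isUnramifiedAt
    (Rec : ReciprocityData K) (ι : PadicAlgCl ℓ ≃+* ℂ)
    (π : AutomorphicRepData (AutomorphyDatum.gl n K hcpt)) (ρ : FramedGaloisRep K (PadicAlgCl ℓ) n)
    {v : HeightOneSpectrum (𝓞 K)} (hv : ((ℓ : ℕ) : 𝓞 K) ∉ v.asIdeal) (hρ : ρ.IsUnramifiedAt v)
    (ht : ∃ t : WeilGroup.inertia (v.adicCompletion K) →* Multiplicative (PadicAlgCl ℓ),
      ∃ u : WeilGroup.inertia (v.adicCompletion K), t u ≠ 1) :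
    LocalGlobalCompatibleAt Rec ι π ρ v ↔
      ∃ (πv : SmoothIrrep (GL (Fin n) (v.adicCompletion K)))
        (rℂ : WeilDeligneRep (v.adicCompletion K) ℂ (Fin n → ℂ)),
        π.HasLocalComponentAt v πv.ρ ∧
          (WeilDeligneRep.ofRep ((ρ.toLocal v).weilRestrict (v.adicCompletion K))
            (isLocallyUnramified_toLocal_of_isUnramifiedAt ρ v hρ).isUnramifiedRep_weilRestrict.isContinuousRep).IsTransportAlong
              (ι : PadicAlgCl ℓ →+* ℂ) rℂ ∧
          rℂ.HasFrobSemisimpleClass ((Rec.llc v).recGL n (IrrClass.mk πv)) :=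
  ⟨exists_of_localGlobalCompatibleAt_away_of_isUnramifiedAt Rec ι π ρ hv hρ,
    fun ⟨πv, rℂ, hπv, htr, hcls⟩ =>
      localGlobalCompatibleAt_away_of_isUnramifiedAt Rec ι π ρ hv hρ ht πv hπv rℂ htr hcls⟩

/-- **Registered stub `stub_awayUnramified_iff_of_inertiaCharacter` of line `Sketch` (crux
stmt-Langlands-14328; the `v ∤ ℓ` twin of `localGlobalCompatibleAt_above_iff_of_isUnramifiedAt`),
closed form of `localGlobalCompatibleAt_away_iff_of_isUnramifiedAt`.**  At a place `v ∤ ℓ` where `ρ`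
is unramified, granted a character of `I_{K_v}` with values in `ℚ̄_ℓ` that is not identically `1`,
`LocalGlobalCompatibleAt Rec ι π ρ v` holds iff some local component `π_v` of `π` at `v` has
`rec_v(π_v)` equal to the Frobenius-semisimple class of a transport of `(ρ|_{W_{K_v}}, N = 0)` along
`ι` (`⇒`: the recipe returns `(ρ|_{W}, 0)` itself, `IsWeilDeligneOfLadic.toMatrix'_ρ_eq_of_forall_inertia`;
`⇐`: `IsWeilDeligneOfLadic.of_N_eq_zero` with `U = I_{K_v}`, the given character, and a geometric
Frobenius from `WeilGroup.deg_surjective`). [cite: DeligneAntwerpII1973, §8.4.2]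
[cite: TateCorvallis1979, (4.1.3)–(4.2.1)] -/
theorem stub_awayUnramified_iff_of_inertiaCharacter :
    ∀ (K : Type) [Field K] [NumberField K] (ℓ : ℕ) [Fact ℓ.Prime] (n : ℕ)
      (hcpt : isCompact_glFiniteIntegralLevel n K) (Rec : ReciprocityData K) (ι : PadicAlgCl ℓ ≃+* ℂ)
      (π : AutomorphicRepData (AutomorphyDatum.gl n K hcpt)) (ρ : FramedGaloisRep K (PadicAlgCl ℓ) n)
      (v : HeightOneSpectrum (𝓞 K)), ((ℓ : ℕ) : 𝓞 K) ∉ v.asIdeal → ∀ hρ : ρ.IsUnramifiedAt v,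
      (∃ t : WeilGroup.inertia (v.adicCompletion K) →* Multiplicative (PadicAlgCl ℓ),
        ∃ u : WeilGroup.inertia (v.adicCompletion K), t u ≠ 1) →
      (LocalGlobalCompatibleAt Rec ι π ρ v ↔
        ∃ (πv : SmoothIrrep (GL (Fin n) (v.adicCompletion K)))
          (rℂ : WeilDeligneRep (v.adicCompletion K) ℂ (Fin n → ℂ)),
          π.HasLocalComponentAt v πv.ρ ∧
            (WeilDeligneRep.ofRep ((ρ.toLocal v).weilRestrict (v.adicCompletion K))
              (isLocallyUnramified_toLocal_of_isUnramifiedAt ρ v hρ).isUnramifiedRep_weilRestrict.isContinuousRep).IsTransportAlong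
                (ι : PadicAlgCl ℓ →+* ℂ) rℂ ∧
            rℂ.HasFrobSemisimpleClass ((Rec.llc v).recGL n (IrrClass.mk πv))) :=
  fun _ _ _ _ _ _ _ Rec ι π ρ _ hv hρ ht =>
    localGlobalCompatibleAt_away_iff_of_isUnramifiedAt Rec ι π ρ hv hρ ht

end Summit

end Summit.Langlands.Langlands.Theorems.ReciprocityUpToIrreducibility

end
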